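import Summits.QuantumFields.BalabanUV.T4Continuum.Support.NE3FlatHodgeSplit
import Summits.QuantumFields.BalabanUV.T4Continuum.Support.NE7LatticeHodgeGradient
import Summits.QuantumFields.BalabanUV.T4Continuum.Support.NE7LatticeLandauMinimiser
import HarnessLib

/-!
# NE7 — THE SUP (OSCILLATION) LETTER OF A PERIODIC BOND FIELD FROM ITS CURL AND ITS DIVERGENCE, WITH NO LOGARITHM: on the torus of period `P`,
# `‖A(x)_ν − A(x′)_ν‖ ≤ 2·16d²P·(d·C_curl + C_div)` — ONE derivative of the periodic potentials of `dA` and `div A`, bounded by the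
# sup-regularity of the lattice Laplacian (F309a)

Cell `pub-balaban`, rung (B)+1 sub-cell t4, lineage `b2b-balaban-t4-ne7-p1` (CRUX PROVER NE7 #1 = OWNER of row NE7), generation 93; memo
`t4/b2b-balaban-t4-ne7-p1-g93/UHLENBECK-ROAD.md` §2.  Second brick of road (U-CM) (the a priori sup estimate of a lattice Landau gauge).  Over
`NE3FlatHodgeSplit.exists_periodic_lap_eq` (periodic Poisson equation, entrywise), (156) `NE7LatticeHodgeGradient.laplacian_eq_sum_dCurl_add_dDiv`
(`−Δ = δd + dδ` on bond fields) and R37 `NE3DiscreteGradientEstimate.supRegularity_of_blockMeanZero` (at `N = 1`, `M = P`: a `P`-periodic mean-zero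
`u` with `‖Δu‖ ≤ B` has `‖∇u‖ ≤ 16d²P·B` and `‖u‖ ≤ 16d³P²·B`).

THE POINT (memo §2; gen 92's warning «never through the axial decomposition»).  A bond field is ONE derivative of potentials: with `Δβ_{μν} = dA(·;μ,ν)`,
`Δφ = div A` (periodic potentials), `A′_ν := Σ_μ ∇_μ^* β_{μν} + ∇_ν φ` has `ΔA′ = ΔA` componentwise by (156), so `A_ν − A′_ν` is periodic and
harmonic, hence CONSTANT; and `‖A′‖ ≤ d·16d²P·sup‖dA‖ + 16d²P·sup‖div A‖` by the GRADIENT half of R37 — the potentials themselves (size `P²`) are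
never used.  No Riesz transform, no logarithm; the constant is killed downstream by a bond where `A` vanishes (the straddling bonds of F308).

WHAT ([folklore] lattice potential theory; 0 def, 0 sorry): `exists_periodic_lap_eq_matrix` (matrix-valued periodic Poisson equation),
`exists_periodic_potential_grad_le` (a periodic potential with the R37 gradient bound), `periodic_harmonic_const` (periodic + harmonic ⟹ constant),
and **`osc_le_of_curl_div`** (the oscillation letter above).
HONEST FRAMING (page 1): linear lattice analysis on `ℤᵈ`; nothing of Bałaban's asserted; NE7 NOT PROVED here; spine 0∕9; finite T⁴ rung (B)+1 —
NOT infinite volume, NOT mass gap, NOT `BetaPertH`, NOT Clay.  No `sorry`; axioms ⊆ {propext, Classical.choice, Quot.sound}.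
-/

set_option autoImplicit false

open scoped BigOperators Matrix.Norms.L2Operator
open Finset

namespace Summit.QuantumFields.BalabanUV.T4Continuum.NE7TorusSupFromCurlDiv

open Literature.MathematicalPhysics.QuantumFieldTheory.Balaban1983to89
open B7Prop1Explicit
open T4AveragingDeficitWallBoundary (periodBox mem_periodBox card_periodBox)
open AveragingDeficitTorusChart (periodic_smul_vec)
open NE3DiscreteGradientEstimate (supRegularity_of_blockMeanZero)
open NE3FlatHodgeSplit (exists_periodic_lap_eq)
open NE7LatticeHodgeGradient (laplacian_eq_sum_dCurl_add_dDiv)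
open NE7LatticeLandauMinimiser (sum_periodBox_shift_vec)

noncomputable section

variable {d : ℕ} {n : Type*} [Fintype n] [DecidableEq n]

/-! ## §1 Matrix-valued periodic potentials -/

omit [Fintype n] [DecidableEq n] in
/-- **THE PERIODIC POISSON EQUATION, MATRIX-VALUED**: for `P ≥ 1`, a `P`-periodic `f : ℤᵈ → M_n(ℂ)` with zero period sum is the lattice Laplacian
`Σ_i [(ζ(x+e_i) − ζ x) − (ζ x − ζ(x−e_i))]` of a `P`-periodic `ζ` (entrywise `NE3FlatHodgeSplit.exists_periodic_lap_eq`). [folklore] -/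
theorem exists_periodic_lap_eq_matrix {P : ℕ} (hP : 1 ≤ P) (f : Site d → Matrix n n ℂ)
    (hf : ∀ (x : Site d) (τ : Fin d), f (x + (P : ℤ) • e τ) = f x) (hf0 : ∑ x ∈ periodBox (d := d) P, f x = 0) :
    ∃ ζ : Site d → Matrix n n ℂ, (∀ (x : Site d) (τ : Fin d), ζ (x + (P : ℤ) • e τ) = ζ x) ∧
      ∀ x : Site d, ∑ i, ((ζ (x + e i) - ζ x) - (ζ x - ζ (x - e i))) = f x := by
  haveI : NeZero P := ⟨by omega⟩
  have hentry : ∀ a b : n, ∃ ζ : Site d → ℂ, (∀ (x : Site d) (τ : Fin d), ζ (x + (P : ℤ) • e τ) = ζ x) ∧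
      ∀ x : Site d, ∑ μ : Fin d, (ζ (x + e μ) - 2 * ζ x + ζ (x - e μ)) = f x a b := by
    intro a b
    refine exists_periodic_lap_eq (d := d) (P := P) (fun x => f x a b) (fun x τ => by simp only [hf]) ?_
    have h := congr_fun (congr_fun hf0 a) b
    rw [Matrix.sum_apply] at h
    simpa using h
  choose ζ hζP hζ using hentry
  refine ⟨fun x => Matrix.of fun a b => ζ a b x, fun x τ => ?_, fun x => ?_⟩
  · ext a b; simp only [Matrix.of_apply, hζP]
  · ext a b
    simp only [Matrix.sum_apply, Matrix.sub_apply, Matrix.of_apply]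
    rw [← hζ a b x]
    exact Finset.sum_congr rfl fun μ _ => by ring

/-- **A PERIODIC POTENTIAL WITH THE R37 GRADIENT BOUND**: for `d ≥ 1`, `P ≥ 1` and a `P`-periodic `g` with zero period sum and `‖g‖ ≤ B`, there is a
`P`-periodic `ζ` with `Δζ = g` and `‖ζ(x + e_i) − ζ x‖ ≤ 16d²·P·B` everywhere (the potential minus its period mean is block-mean-zero for
`supRegularity_of_blockMeanZero` at `N = 1`, `M = P`). [folklore] -/
theorem exists_periodic_potential_grad_le (hd : 1 ≤ d) {P : ℕ} (hP : 1 ≤ P) (g : Site d → Matrix n n ℂ)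
    (hg : ∀ (x : Site d) (τ : Fin d), g (x + (P : ℤ) • e τ) = g x) (hg0 : ∑ x ∈ periodBox (d := d) P, g x = 0)
    {B : ℝ} (hB : ∀ x, ‖g x‖ ≤ B) :
    ∃ ζ : Site d → Matrix n n ℂ, (∀ (x : Site d) (τ : Fin d), ζ (x + (P : ℤ) • e τ) = ζ x) ∧
      (∀ x : Site d, ∑ i, ((ζ (x + e i) - ζ x) - (ζ x - ζ (x - e i))) = g x) ∧
      ∀ (x : Site d) (i : Fin d), ‖ζ (x + e i) - ζ x‖ ≤ 16 * (d : ℝ) ^ 2 * P * B := by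
  obtain ⟨ζ₀, hζ₀P, hζ₀⟩ := exists_periodic_lap_eq_matrix hP g hg hg0
  -- subtract the period mean
  set c : Matrix n n ℂ := ((P : ℂ) ^ d)⁻¹ • ∑ v ∈ periodBox (d := d) P, ζ₀ v with hc
  set ζ : Site d → Matrix n n ℂ := fun x => ζ₀ x - c with hζ_def
  have hζP : ∀ (x : Site d) (τ : Fin d), ζ (x + (P : ℤ) • e τ) = ζ x := fun x τ => by simp only [hζ_def, hζ₀P]
  have hdiff : ∀ x y : Site d, ζ x - ζ y = ζ₀ x - ζ₀ y := fun x y => by simp only [hζ_def]; abel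
  have hζlap : ∀ x : Site d, ∑ i, ((ζ (x + e i) - ζ x) - (ζ x - ζ (x - e i))) = g x := fun x => by
    simp only [hdiff]; exact hζ₀ x
  have hmean : ∀ z : Site d, ∑ v ∈ periodBox (d := d) P, ζ ((P : ℤ) • z + v) = 0 := by
    intro z
    have h1 : ∀ v : Site d, ζ ((P : ℤ) • z + v) = ζ v := fun v => by rw [add_comm]; exact periodic_smul_vec hζP v z
    rw [Finset.sum_congr rfl fun v _ => h1 v]
    simp only [hζ_def, Finset.sum_sub_distrib, Finset.sum_const, card_periodBox]
    rw [← Nat.cast_smul_eq_nsmul ℂ, hc, smul_smul]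
    have hPne : ((P : ℂ) ^ d) ≠ 0 := pow_ne_zero _ (by exact_mod_cast (show P ≠ 0 by omega))
    rw [show ((P ^ d : ℕ) : ℂ) * ((P : ℂ) ^ d)⁻¹ = 1 by push_cast; field_simp, one_smul, sub_self]
  have hreg := supRegularity_of_blockMeanZero (E := Matrix n n ℂ) hd (M := P) (N := 1) hP le_rfl ζ
    (fun x τ => by rw [one_mul]; exact hζP x τ) hmean (B := B) (fun x => by rw [hζlap]; exact hB x)
  refine ⟨ζ, hζP, hζlap, fun x i => hreg.1 x i⟩

/-- **PERIODIC AND HARMONIC ⟹ CONSTANT** (`d ≥ 1`, `P ≥ 1`): a `P`-periodic `h : ℤᵈ → M_n(ℂ)` with vanishing lattice Laplacian is constant (R37's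
sup bound with `B = 0`, applied to `h` minus its period mean). [folklore] -/
theorem periodic_harmonic_const (hd : 1 ≤ d) {P : ℕ} (hP : 1 ≤ P) (h : Site d → Matrix n n ℂ)
    (hh : ∀ (x : Site d) (τ : Fin d), h (x + (P : ℤ) • e τ) = h x)
    (hlap : ∀ x : Site d, ∑ i, ((h (x + e i) - h x) - (h x - h (x - e i))) = 0) (x y : Site d) : h x = h y := by
  set c : Matrix n n ℂ := ((P : ℂ) ^ d)⁻¹ • ∑ v ∈ periodBox (d := d) P, h v with hc
  set u : Site d → Matrix n n ℂ := fun x => h x - c with hu_def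
  have huP : ∀ (x : Site d) (τ : Fin d), u (x + (P : ℤ) • e τ) = u x := fun x τ => by simp only [hu_def, hh]
  have hdiff : ∀ x y : Site d, u x - u y = h x - h y := fun x y => by simp only [hu_def]; abel
  have hulap : ∀ x : Site d, ∑ i, ((u (x + e i) - u x) - (u x - u (x - e i))) = 0 := fun x => by
    simp only [hdiff]; exact hlap x
  have hmean : ∀ z : Site d, ∑ v ∈ periodBox (d := d) P, u ((P : ℤ) • z + v) = 0 := by
    intro z
    have h1 : ∀ v : Site d, u ((P : ℤ) • z + v) = u v := fun v => by rw [add_comm]; exact periodic_smul_vec huP v z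
    rw [Finset.sum_congr rfl fun v _ => h1 v]
    simp only [hu_def, Finset.sum_sub_distrib, Finset.sum_const, card_periodBox]
    rw [← Nat.cast_smul_eq_nsmul ℂ, hc, smul_smul]
    have hPne : ((P : ℂ) ^ d) ≠ 0 := pow_ne_zero _ (by exact_mod_cast (show P ≠ 0 by omega))
    rw [show ((P ^ d : ℕ) : ℂ) * ((P : ℂ) ^ d)⁻¹ = 1 by push_cast; field_simp, one_smul, sub_self]
  have hreg := supRegularity_of_blockMeanZero (E := Matrix n n ℂ) hd (M := P) (N := 1) hP le_rfl u
    (fun x τ => by rw [one_mul]; exact huP x τ) hmean (B := 0) (fun x => by rw [hulap, norm_zero])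
  have hux : u x = 0 := by have := hreg.2 x; rw [mul_zero] at this; exact norm_le_zero_iff.1 this
  have huy : u y = 0 := by have := hreg.2 y; rw [mul_zero] at this; exact norm_le_zero_iff.1 this
  have := hdiff x y
  rw [hux, huy, sub_self] at this
  exact (sub_eq_zero.1 this.symm)

/-! ## §2 Linear bookkeeping for the explicit lattice Laplacian -/

section Generic

variable {E : Type*} [AddCommGroup E]

/-- The lattice Laplacian of a pointwise sum. [folklore] -/
theorem lap_add_fun (u v : Site d → E) (x : Site d) :
    ∑ i, (((u (x + e i) + v (x + e i)) - (u x + v x)) - ((u x + v x) - (u (x - e i) + v (x - e i))))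
      = ∑ i, ((u (x + e i) - u x) - (u x - u (x - e i))) + ∑ i, ((v (x + e i) - v x) - (v x - v (x - e i))) := by
  rw [← Finset.sum_add_distrib]; exact Finset.sum_congr rfl fun i _ => by abel

/-- The lattice Laplacian of a pointwise difference. [folklore] -/
theorem lap_sub_fun (u v : Site d → E) (x : Site d) :
    ∑ i, (((u (x + e i) - v (x + e i)) - (u x - v x)) - ((u x - v x) - (u (x - e i) - v (x - e i))))
      = ∑ i, ((u (x + e i) - u x) - (u x - u (x - e i))) - ∑ i, ((v (x + e i) - v x) - (v x - v (x - e i))) := by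
  rw [← Finset.sum_sub_distrib]; exact Finset.sum_congr rfl fun i _ => by abel

/-- The lattice Laplacian of a finite sum of functions. [folklore] -/
theorem lap_sum_fun (g : Fin d → Site d → E) (x : Site d) :
    ∑ i, (((∑ μ, g μ (x + e i)) - ∑ μ, g μ x) - ((∑ μ, g μ x) - ∑ μ, g μ (x - e i)))
      = ∑ μ, ∑ i, ((g μ (x + e i) - g μ x) - (g μ x - g μ (x - e i))) := by
  rw [Finset.sum_comm]
  exact Finset.sum_congr rfl fun i _ => by simp only [Finset.sum_sub_distrib]

/-- The lattice Laplacian commutes with translations (additive form). [folklore] -/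
theorem lap_shift_add (u : Site d → E) (x v : Site d) :
    ∑ i, ((u (x + e i + v) - u (x + v)) - (u (x + v) - u (x - e i + v)))
      = ∑ i, ((u (x + v + e i) - u (x + v)) - (u (x + v) - u (x + v - e i))) :=
  Finset.sum_congr rfl fun i _ => by rw [show x + e i + v = x + v + e i by abel, show x - e i + v = x + v - e i by abel]

/-- The lattice Laplacian commutes with translations (subtractive form). [folklore] -/
theorem lap_shift_sub (u : Site d → E) (x w : Site d) :
    ∑ i, ((u (x + e i - w) - u (x - w)) - (u (x - w) - u (x - e i - w)))
      = ∑ i, ((u (x - w + e i) - u (x - w)) - (u (x - w) - u (x - w - e i))) :=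
  Finset.sum_congr rfl fun i _ => by rw [show x + e i - w = x - w + e i by abel, show x - e i - w = x - w - e i by abel]

end Generic

/-! ## §3 The oscillation letter from the curl and the divergence -/

set_option maxHeartbeats 800000 in
/-- **THE SUP (OSCILLATION) LETTER OF A PERIODIC BOND FIELD FROM ITS CURL AND ITS DIVERGENCE — NO LOGARITHM.**  For `d ≥ 1`, `P ≥ 1` and a
`P`-periodic bond field `A : ℤᵈ → (Fin d → M_n(ℂ))` with `‖dA(x;μ,ν)‖ ≤ C_c` (all `x`, all ordered pairs) and `‖div A(x)‖ ≤ C_d`: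
`‖A(x)_ν − A(x′)_ν‖ ≤ 2·16d²P·(d·C_c + C_d)` for all `x, x′, ν` — `A_ν = Σ_μ ∇_μ^*β_{μν} + ∇_νφ + const` with periodic potentials `Δβ = dA`,
`Δφ = div A`, and R37's gradient bound on the potentials. [folklore] -/
theorem osc_le_of_curl_div (hd : 1 ≤ d) {P : ℕ} (hP : 1 ≤ P) (A : Site d → Fin d → Matrix n n ℂ)
    (hA : ∀ (x : Site d) (τ μ : Fin d), A (x + (P : ℤ) • e τ) μ = A x μ) {Cc Cd : ℝ}
    (hCc : ∀ (x : Site d) (μ ν : Fin d), ‖A x μ + A (x + e μ) ν - A (x + e ν) μ - A x ν‖ ≤ Cc)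
    (hCd : ∀ x : Site d, ‖∑ κ, (A x κ - A (x - e κ) κ)‖ ≤ Cd) (x x' : Site d) (ν : Fin d) :
    ‖A x ν - A x' ν‖ ≤ 2 * (16 * (d : ℝ) ^ 2 * P * ((d : ℝ) * Cc + Cd)) := by
  have hCc0 : 0 ≤ Cc := (norm_nonneg _).trans (hCc 0 ν ν)
  have hCd0 : 0 ≤ Cd := (norm_nonneg _).trans (hCd 0)
  have hd0 : (0 : ℝ) ≤ d := Nat.cast_nonneg d
  have hP0 : (0 : ℝ) ≤ P := Nat.cast_nonneg P
  -- periodicity bookkeeping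
  have hAper : ∀ (x v : Site d) (τ μ : Fin d), A (x + (P : ℤ) • e τ + v) μ = A (x + v) μ := fun x v τ μ => by
    rw [add_right_comm, hA]
  have hAper' : ∀ (x v : Site d) (τ μ : Fin d), A (x + (P : ℤ) • e τ - v) μ = A (x - v) μ := fun x v τ μ => by
    rw [sub_eq_add_neg, sub_eq_add_neg, hAper]
  -- §a the curl potentials
  have hcurl : ∀ μ : Fin d, ∃ β : Site d → Matrix n n ℂ, (∀ (x : Site d) (τ : Fin d), β (x + (P : ℤ) • e τ) = β x) ∧
      (∀ x : Site d, ∑ i, ((β (x + e i) - β x) - (β x - β (x - e i))) = A x μ + A (x + e μ) ν - A (x + e ν) μ - A x ν) ∧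
      ∀ (x : Site d) (i : Fin d), ‖β (x + e i) - β x‖ ≤ 16 * (d : ℝ) ^ 2 * P * Cc := by
    intro μ
    refine exists_periodic_potential_grad_le hd hP (fun x => A x μ + A (x + e μ) ν - A (x + e ν) μ - A x ν)
      (fun x τ => by simp only [hAper, hA]) ?_ (fun x => hCc x μ ν)
    simp only [Finset.sum_sub_distrib, Finset.sum_add_distrib]
    rw [sum_periodBox_shift_vec hP (g := fun y => A y ν) (fun y κ => hA y κ ν) (e μ),
      sum_periodBox_shift_vec hP (g := fun y => A y μ) (fun y κ => hA y κ μ) (e ν)]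
    abel
  choose β hβP hβlap hβgrad using hcurl
  -- §b the divergence potential
  obtain ⟨φ, hφP, hφlap, hφgrad⟩ : ∃ φ : Site d → Matrix n n ℂ, (∀ (x : Site d) (τ : Fin d), φ (x + (P : ℤ) • e τ) = φ x) ∧
      (∀ x : Site d, ∑ i, ((φ (x + e i) - φ x) - (φ x - φ (x - e i))) = ∑ κ, (A x κ - A (x - e κ) κ)) ∧
      ∀ (x : Site d) (i : Fin d), ‖φ (x + e i) - φ x‖ ≤ 16 * (d : ℝ) ^ 2 * P * Cd := by
    refine exists_periodic_potential_grad_le hd hP (fun x => ∑ κ, (A x κ - A (x - e κ) κ))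
      (fun x τ => by simp only [hAper', hA]) ?_ hCd
    rw [Finset.sum_comm]
    refine Finset.sum_eq_zero fun κ _ => ?_
    rw [Finset.sum_sub_distrib, sub_eq_zero]
    have h := sum_periodBox_shift_vec hP (g := fun y => A y κ) (fun y τ => hA y τ κ) (-e κ)
    simp only [← sub_eq_add_neg] at h
    exact h.symm
  -- §c the reconstructed field `A′` and the harmonic remainder
  set A' : Site d → Matrix n n ℂ := fun x => ∑ μ, (β μ x - β μ (x - e μ)) + (φ (x + e ν) - φ x) with hA'_def
  have hA'P : ∀ (x : Site d) (τ : Fin d), A' (x + (P : ℤ) • e τ) = A' x := by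
    intro x τ
    simp only [hA'_def]
    rw [show x + (P : ℤ) • e τ + e ν = (x + e ν) + (P : ℤ) • e τ by abel, hφP, hφP]
    congr 1
    refine Finset.sum_congr rfl fun μ _ => ?_
    rw [show x + (P : ℤ) • e τ - e μ = (x - e μ) + (P : ℤ) • e τ by abel, hβP, hβP]
  -- the Laplacian of `A′` equals that of `A_ν`
  have hlapA' : ∀ x : Site d, ∑ i, ((A' (x + e i) - A' x) - (A' x - A' (x - e i)))
      = ∑ i, ((A (x + e i) ν - A x ν) - (A x ν - A (x - e i) ν)) := by
    intro x
    rw [laplacian_eq_sum_dCurl_add_dDiv A x ν]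
    have hexp : ∑ i, ((A' (x + e i) - A' x) - (A' x - A' (x - e i)))
        = ∑ μ, (∑ i, ((β μ (x + e i) - β μ x) - (β μ x - β μ (x - e i)))
            - ∑ i, ((β μ (x - e μ + e i) - β μ (x - e μ)) - (β μ (x - e μ) - β μ (x - e μ - e i))))
          + (∑ i, ((φ (x + e ν + e i) - φ (x + e ν)) - (φ (x + e ν) - φ (x + e ν - e i)))
            - ∑ i, ((φ (x + e i) - φ x) - (φ x - φ (x - e i)))) := by
      simp only [hA'_def]
      rw [lap_add_fun (fun y => ∑ μ, (β μ y - β μ (y - e μ))) (fun y => φ (y + e ν) - φ y) x,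
        lap_sum_fun (fun μ y => β μ y - β μ (y - e μ)) x,
        lap_sub_fun (fun y => φ (y + e ν)) φ x, lap_shift_add φ x (e ν)]
      congr 1
      refine Finset.sum_congr rfl fun μ _ => ?_
      rw [lap_sub_fun (β μ) (fun y => β μ (y - e μ)) x, lap_shift_sub (β μ) x (e μ)]
    rw [hexp]
    simp only [hβlap, hφlap]
  -- the remainder `A_ν − A′` is periodic and harmonic, hence constant
  have hconst : ∀ y y' : Site d, A' y - A y ν = A' y' - A y' ν := by
    intro y y'
    refine periodic_harmonic_const hd hP (fun z => A' z - A z ν) (fun z τ => by simp only [hA, hA'P]) (fun z => ?_) y y'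
    have h := hlapA' z
    rw [← sub_eq_zero] at h
    rw [← h, ← Finset.sum_sub_distrib]
    exact Finset.sum_congr rfl fun i _ => by abel
  -- §d the bound on `A′`
  have hA'b : ∀ y : Site d, ‖A' y‖ ≤ 16 * (d : ℝ) ^ 2 * P * ((d : ℝ) * Cc + Cd) := by
    intro y
    have h1 : ‖∑ μ, (β μ y - β μ (y - e μ))‖ ≤ (d : ℝ) * (16 * (d : ℝ) ^ 2 * P * Cc) := by
      calc ‖∑ μ, (β μ y - β μ (y - e μ))‖ ≤ ∑ μ : Fin d, (16 * (d : ℝ) ^ 2 * P * Cc) :=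
            norm_sum_le_of_le _ fun μ _ => by
              have h := hβgrad μ (y - e μ) μ
              rwa [sub_add_cancel] at h
        _ = (d : ℝ) * (16 * (d : ℝ) ^ 2 * P * Cc) := by
            rw [Finset.sum_const, Finset.card_univ, Fintype.card_fin, nsmul_eq_mul]
    have h2 : ‖φ (y + e ν) - φ y‖ ≤ 16 * (d : ℝ) ^ 2 * P * Cd := hφgrad y ν
    calc ‖A' y‖ ≤ ‖∑ μ, (β μ y - β μ (y - e μ))‖ + ‖φ (y + e ν) - φ y‖ := norm_add_le _ _
      _ ≤ (d : ℝ) * (16 * (d : ℝ) ^ 2 * P * Cc) + 16 * (d : ℝ) ^ 2 * P * Cd := add_le_add h1 h2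
      _ = 16 * (d : ℝ) ^ 2 * P * ((d : ℝ) * Cc + Cd) := by ring
  -- §e conclusion
  have hid : A x ν - A x' ν = A' x - A' x' := by
    have h := hconst x x'
    rw [sub_eq_sub_iff_sub_eq_sub] at h
    exact h.symm
  rw [hid]
  calc ‖A' x - A' x'‖ ≤ ‖A' x‖ + ‖A' x'‖ := norm_sub_le _ _
    _ ≤ 16 * (d : ℝ) ^ 2 * P * ((d : ℝ) * Cc + Cd) + 16 * (d : ℝ) ^ 2 * P * ((d : ℝ) * Cc + Cd) := add_le_add (hA'b x) (hA'b x')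
    _ = 2 * (16 * (d : ℝ) ^ 2 * P * ((d : ℝ) * Cc + Cd)) := by ring

end

end Summit.QuantumFields.BalabanUV.T4Continuum.NE7TorusSupFromCurlDiv
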